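import Literature.NumberTheory.EllipticCurves.HeegnerPointsKolyvaginPrimaryDescentProofs
import HarnessLib

/-!
# Kolyvagin's annihilator `C = p^{M₀}`: `p^{M₀} · S_{p^M}(E/K) ⊆ ℤ δ_M x₀` from the mod-`p^M`
# descent data and reciprocity at TWO Kolyvagin primes

Sibling proof file (theorems only: no definition, no named fact, no `sorry`) of
`HeegnerPointsKolyvaginPrimaryDescentProofs`.

The abstract descent `KolyvaginDescent.HypothesesM` (Gross 1991, §10 carried out modulo `p^M` with
McCallum's order bookkeeping) proves `p^{M₀} · Sel^{-ε} = 0` (Claim A, Gross Claim 10.1) and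
`p^{2M₀} · Sel^{ε} ⊆ ℤ x` (Claim B, Gross Claim 10.3), hence the annihilation
`p^{2M₀} · Sel ⊆ ℤ x` (`HypothesesM.pow_zsmul_mem_zmultiples`).  Kolyvagin's own annihilator is
`C = p^{M₀}` (V. A. Kolyvagin, Proc. ICM Kyoto 1990, §2: *"`C' S'_M = 0` … the divisor and main
component of which is `C`"*, `C = p^{M₀}`; the order form `[Ш] ∣ C²` of McCallum 1991, §1 Theorem
is NOT addressed here).  The factor `p^{M₀}` lost in Claim B is the price of making
`p^{M₀} c(ℓℓ')` Selmer at `λ` through Claim A; it is recovered by the reciprocity law at the TWO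
places `λ, λ'` (McCallum 1991, §2 Prop. 2.2: *"`Σ_v ⟨s_v, c_v⟩ = 0`"*, the sum over ALL places, as
used with two possibly non-zero terms in the proof of Prop. 5.2, PDF p. 287 of the held Durham
volume): pairing `c(ℓℓ') ∈ H¹(K, E_{p^M})^{ε}` — Selmer off `{λ, λ'}` — with `x` itself, which is
Selmer everywhere, vanishes at `λ'` and generates `(E(K_λ)/p^M)^{ε}` at `λ`, kills the singular part
of `c(ℓℓ')` at `λ`; so `c(ℓℓ')` is Selmer off `λ'` alone, with `ord d_M(ℓℓ')_{λ'} = ord c(ℓ) ≥ p^{M-M₀}`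
(Prop. 4.4), and single-place duality at `λ'` bounds every `s ∈ Sel^{ε}` independent of `x` by
`ord s ≤ p^{M₀}`.

## What is proved (abstract, for `S : HypothesesM V Pl`)

The two-place reciprocity enters as the HYPOTHESIS `hdual₂` (same shape as the field
`HypothesesM.duality`, with a second Kolyvagin place `λ' ≠ λ` at which `d` may fail the Selmer
condition and at which `s` vanishes):

* `HypothesesM.mem_loc_of_duality₂_of_generator` — a `ν`-eigenclass `d` Selmer off `{λ, λ'}` is
  Selmer at `λ` as soon as some `s ∈ Sel^{ν}` vanishes at `λ'` and has `ord s_λ = p^M`;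
* `HypothesesM.claimB_indep_of_duality₂` — **`p^{M₀} s = 0`** for `s ∈ Sel^{ε}` independent of `x`;
* `HypothesesM.claimB_of_duality₂` — `p^{M₀} s ∈ ℤ x` for `s ∈ Sel^{ε}`;
* `HypothesesM.pow_M₀_zsmul_mem_zmultiples` — **`p^{M₀} · Sel ⊆ ℤ x`** (with Claim A);
* `pow_M₀_smul_sha_primary_eq_zero_of_hypothesesM_of_le` — for an elliptic curve over a number
  field: such data on `H¹(K, E[p^j])` for all `j ≥ j₀` with a common `M₀`, `Sel = Sel^{(p^j)}(E/K)`,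
  `x ∈ δ(E(K))` and `hdual₂` at every level give **`p^{M₀} · Ш(E/K)[p^∞] = 0`** (the passage to `Ш`
  of `finite_sha_primary_of_hypothesesM_of_le` / `pow_smul_sha_primary_eq_zero_of_hypothesesM_of_le`).

The concrete two-place reciprocity (from Poitou–Tate, the sum over the places `{λ, λ'}`) and the
leaves at one prime are the business of the sibling `…AnnihilatorLeavesProofs`.

## References

* [McCallumLMS1991] W. G. McCallum, *Kolyvagin's work on Shafarevich–Tate groups*, LMS Lecture
  Note Ser. 153 (1991), 295–316: §1 Theorem (Kolyvagin), §2 Prop. 2.2, §4 Lemma 4.3 / Prop. 4.4,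
  §5 Lemma 5.1, Lemma 5.3, proof of Prop. 5.2 (held, PDF pp. 276–287).
* [GrossLMS1991] B. H. Gross, *Kolyvagin's work on modular elliptic curves*, same volume, §10
  Claims 10.1 / 10.3, Prop. 10.2 (held, PDF pp. 229–231).
* [Kolyvagin1990] V. A. Kolyvagin, *On the Mordell–Weil group and the Shafarevich–Tate group of
  modular elliptic curves*, Proc. ICM Kyoto 1990, vol. I, 429–436, §2 (read: galaxy
  panama:376007206895683); *Euler systems*, Grothendieck Festschrift II (1990), Thm. A (cite only).

presearch: "Kolyvagin annihilator p^{M_0} two primes reciprocity" → [corpus: book:editornd-l-functions-arithmetic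
McCallum p. 306 (PDF p0287), proof of Prop. 5.2: two-term reciprocity sum] gives the device;
tree `lean search 'pow_zsmul_mem_zmultiples'` → exponent `2 * M₀` only; galaxy: ICM 1990 §2 only.
-/

noncomputable section

open scoped Classical
open WeierstrassCurve NumberField IsDedekindDomain

universe u

namespace Literature.NumberTheory.EllipticCurves

namespace KolyvaginDescent

namespace HypothesesM

variable {V : Type*} [AddCommGroup V] {Pl : Type*} (S : HypothesesM V Pl)

/-! ## Two-place duality kills the singular part at a place where a Selmer generator lives -/

/-- **A class Selmer off `{λ, λ'}` is Selmer at `λ` if a Selmer eigenclass of the same sign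
vanishes at `λ'` and has full order `p^M` at `λ`** (reciprocity over the two places `λ, λ'`,
McCallum 1991, §2 Prop. 2.2 with Lemma 5.3: the term at `λ'` vanishes, so the term at `λ` does,
and `s_λ` generates the cyclic group `(E(K_λ)/p^M)^{ν}` of order `p^M`). Here from the two-place
duality hypothesis `hdual₂` in order form. [cite: McCallumLMS1991, §2 Prop. 2.2, §5 Lemma 5.3] -/
theorem mem_loc_of_duality₂_of_generator
    (hdual₂ : ∀ ℓ ℓ', S.Kol ℓ → S.Kol ℓ' → ℓ ≠ ℓ' → ∀ ν : ℤ, (ν = 1 ∨ ν = -1) → ∀ d, S.τ d = ν • d →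
      (∀ v, v ≠ S.pl ℓ → v ≠ S.pl ℓ' → d ∈ S.Loc v) → ∀ s ∈ S.Sel, S.τ s = ν • s → s ∈ S.A ℓ' →
      ∀ a, a < S.M → ((S.p : ℤ) ^ a) • d ∉ S.Loc (S.pl ℓ) →
        ((S.p : ℤ) ^ (S.M - 1 - a)) • s ∈ S.A ℓ)
    {ℓ ℓ' : ℕ} (hℓ : S.Kol ℓ) (hℓ' : S.Kol ℓ') (hne : ℓ ≠ ℓ') {ν : ℤ} (hν : ν = 1 ∨ ν = -1)
    {d : V} (hd : S.τ d = ν • d) (hoff : ∀ v, v ≠ S.pl ℓ → v ≠ S.pl ℓ' → d ∈ S.Loc v)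
    {s : V} (hs : s ∈ S.Sel) (hτs : S.τ s = ν • s) (hsℓ' : s ∈ S.A ℓ')
    (hsℓ : ((S.p : ℤ) ^ (S.M - 1)) • s ∉ S.A ℓ) : d ∈ S.Loc (S.pl ℓ) := by
  by_contra hdL
  have h0 : ((S.p : ℤ) ^ 0) • d ∉ S.Loc (S.pl ℓ) := by rwa [pow_zero, one_zsmul]
  have h := hdual₂ ℓ ℓ' hℓ hℓ' hne ν hν d hd hoff s hs hτs hsℓ' 0 (Nat.pos_of_ne_zero S.M_ne_zero) h0
  rw [Nat.sub_zero] at h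
  exact hsℓ h

/-! ## Claim B with Kolyvagin's exponent `M₀` -/

/-- **Claim B♯ for classes independent of `x`: `p^{M₀} s = 0`** for `s ∈ Sel^{ε}` with
`ℤ x ∩ ℤ s = 0`, under two-place duality.  With `ord s = p^N`: Cor. 3.2 gives `ℓ` with
`ord x_λ = ord x = p^M`, whence `ord d_M(ℓ)_λ = ord y_λ = p^{M-M₀}` and
`k = ord c(ℓ) ≥ p^{M-M₀}` (Prop. 4.4); then, `x, s, c(ℓ)` being independent eigenclasses,
`ℓ' ≠ ℓ` with `x_{λ'} = 0`, `ord s_{λ'} = p^N`, `ord c(ℓ)_{λ'} = p^k`.  The class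
`c(ℓℓ') ∈ H¹(K, E_{p^M})^{ε}` is Selmer off `{λ, λ'}` (Lemma 4.3); pairing it with `x` over the two
places (`x_{λ'} = 0`, `x_λ` of order `p^M`) makes it Selmer at `λ`
(`mem_loc_of_duality₂_of_generator`), while `ord d_M(ℓℓ')_{λ'} = ord c(ℓ)_{λ'} = p^k` (Prop. 4.4 at
`λ'`); single-place duality at `λ'` gives `ord s_{λ'} ≤ p^{M-k} ≤ p^{M₀}`.
[cite: GrossLMS1991, §10 Claim 10.3] [cite: McCallumLMS1991, §2 Prop. 2.2, §5 proof of Prop. 5.2] -/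
theorem claimB_indep_of_duality₂
    (hdual₂ : ∀ ℓ ℓ', S.Kol ℓ → S.Kol ℓ' → ℓ ≠ ℓ' → ∀ ν : ℤ, (ν = 1 ∨ ν = -1) → ∀ d, S.τ d = ν • d →
      (∀ v, v ≠ S.pl ℓ → v ≠ S.pl ℓ' → d ∈ S.Loc v) → ∀ s ∈ S.Sel, S.τ s = ν • s → s ∈ S.A ℓ' →
      ∀ a, a < S.M → ((S.p : ℤ) ^ a) • d ∉ S.Loc (S.pl ℓ) →
        ((S.p : ℤ) ^ (S.M - 1 - a)) • s ∈ S.A ℓ)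
    {s : V} (hs : s ∈ S.Sel) (hτs : S.τ s = S.ε • s)
    (hind : ∀ a₀ a₁ : ℤ, a₀ • S.x + a₁ • s = 0 → a₁ • s = 0) :
    ((S.p : ℤ) ^ S.M₀) • s = 0 := by
  rcases Nat.lt_or_ge S.M₀ S.M with hM₀ | hM₀
  swap
  · exact pow_zsmul_eq_zero_of_le hM₀ (S.torsion s)
  by_cases hN : S.expo s = 0
  · exact pow_zsmul_eq_zero_of_le (Nat.zero_le _) (by simpa [hN] using S.pow_expo_zsmul s)
  -- Step A: a Kolyvagin prime `ℓ` with `ord x_λ = ord x = p^M`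
  obtain ⟨ℓ, -, hℓ, hloc⟩ := S.cebotarev 1 ![S.x] ![S.M]
    (fun i ↦ by
      fin_cases i
      exact S.x_ne)
    (fun i ↦ by
      fin_cases i
      intro _
      exact S.x_ord)
    (fun i ↦ by
      fin_cases i
      exact ⟨S.ε, S.hε, S.τ_x⟩)
    (fun a ha i ↦ by
      rw [Fin.sum_univ_one] at ha
      fin_cases i
      simpa using ha) 0
  have hxℓ : ((S.p : ℤ) ^ (S.M - 1)) • S.x ∉ S.A ℓ := by
    have := (hloc 0).2 (by simp only [Matrix.cons_val_zero]; exact S.M_ne_zero)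
    simpa using this
  -- `ord y_λ = p^{M - M₀}` (`y = p^{M₀} x`), so `ord d_M(ℓ)_λ = p^{M - M₀}` and `k = ord c(ℓ) ≥ M - M₀`
  have hy : ((S.p : ℤ) ^ (S.M - S.M₀ - 1)) • S.y ∉ S.A ℓ := by
    rw [y, smul_smul, ← pow_add, show S.M - S.M₀ - 1 + S.M₀ = S.M - 1 by omega]
    exact hxℓ
  have hcL : ((S.p : ℤ) ^ (S.M - S.M₀ - 1)) • S.c ℓ ∉ S.Loc (S.pl ℓ) := fun h ↦
    hy ((S.c_mem_loc_iff_one hℓ _).mp h)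
  have hk : S.M - S.M₀ ≤ S.expo (S.c ℓ) := by
    by_contra hlt
    have hlt := Nat.lt_of_not_le hlt
    exact hcL (by
      rw [pow_zsmul_eq_zero_of_le (by omega) (S.pow_expo_zsmul (S.c ℓ))]; exact zero_mem _)
  have hk0 : S.expo (S.c ℓ) ≠ 0 := by omega
  -- Step B: `ℓ' > ℓ` with `x_{λ'} = 0`, `ord s_{λ'} = ord s`, `ord c(ℓ)_{λ'} = ord c(ℓ)`
  obtain ⟨ℓ', hlt, hℓ', hloc'⟩ := S.cebotarev 3 ![S.x, s, S.c ℓ] ![0, S.expo s, S.expo (S.c ℓ)]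
    (fun i ↦ by
      fin_cases i
      · exact S.x_ne
      · exact S.ne_zero_of_expo_ne_zero hN
      · exact S.ne_zero_of_expo_ne_zero hk0)
    (fun i ↦ by
      fin_cases i
      · intro h
        exact absurd rfl h
      · intro h
        exact S.pow_expo_sub_one_zsmul_ne_zero h
      · intro h
        exact S.pow_expo_sub_one_zsmul_ne_zero h)
    (fun i ↦ by
      fin_cases i
      · exact ⟨S.ε, S.hε, S.τ_x⟩
      · exact ⟨S.ε, S.hε, hτs⟩
      · exact ⟨-S.ε, S.neg_ε_sign, S.τ_c_prime hℓ⟩)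
    (fun a ha i ↦ by
      rw [Fin.sum_univ_three] at ha
      simp only [Matrix.cons_val_zero, Matrix.cons_val_one, Matrix.cons_val] at ha
      have := S.indep_of_eigen₃ S.ε_mul_ε S.τ_x hτs (S.τ_c_prime hℓ) hind ha
      fin_cases i
      · exact this.1
      · exact this.2.1
      · exact this.2.2) ℓ
  have hne : ℓ ≠ ℓ' := hlt.ne
  have hxA : S.x ∈ S.A ℓ' := by simpa using (hloc' 0).1
  have hsA : ((S.p : ℤ) ^ (S.expo s - 1)) • s ∉ S.A ℓ' := by
    have := (hloc' 1).2 (by simpa using hN)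
    simpa using this
  have hcA' : ((S.p : ℤ) ^ (S.expo (S.c ℓ) - 1)) • S.c ℓ ∉ S.A ℓ' := by
    have := (hloc' 2).2 (by simpa using hk0)
    simpa using this
  -- Step C: `d = c(ℓℓ')` is Selmer off `{λ, λ'}`, in the `ε`-eigenspace …
  have hsupp : KolSupp S.Kol (ℓ * ℓ') :=
    kolSupp_mul (S.prime_of_kol ℓ hℓ) (S.prime_of_kol ℓ' hℓ') hne hℓ hℓ'
  have hsupp' : KolSupp S.Kol (ℓ' * ℓ) := by rwa [mul_comm] at hsupp
  set d := S.c (ℓ * ℓ') with hd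
  have hτd : S.τ d = S.ε • d := S.τ_c_mul hℓ hℓ' hne
  have hoff₂ : ∀ v, v ≠ S.pl ℓ → v ≠ S.pl ℓ' → d ∈ S.Loc v := by
    intro v hv hv'
    by_cases hdv : S.Dv v (ℓ * ℓ')
    · rcases S.dv_mul ℓ ℓ' hℓ hℓ' v hdv with h | h
      · exact absurd ((S.dv_iff ℓ hℓ v).mp h) hv
      · exact absurd ((S.dv_iff ℓ' hℓ' v).mp h) hv'
    · exact S.c_mem_loc _ hsupp v hdv
  -- … and Selmer at `λ`, by two-place duality against `x` (`x_{λ'} = 0`, `ord x_λ = p^M`)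
  have hatℓ : d ∈ S.Loc (S.pl ℓ) :=
    S.mem_loc_of_duality₂_of_generator hdual₂ hℓ hℓ' hne S.hε hτd hoff₂ S.x_mem S.τ_x hxA hxℓ
  have hoff : ∀ v, v ≠ S.pl ℓ' → d ∈ S.Loc v := by
    intro v hv
    by_cases hvℓ : v = S.pl ℓ
    · rw [hvℓ]
      exact hatℓ
    · exact hoff₂ v hvℓ hv
  -- at `λ'`: `ord d_{λ'} = p^k`, i.e. `p^{k - 1} d ∉ Loc λ'`
  have hat : ((S.p : ℤ) ^ (S.expo (S.c ℓ) - 1)) • d ∉ S.Loc (S.pl ℓ') := by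
    intro h
    rw [hd, mul_comm ℓ ℓ'] at h
    exact hcA' ((S.c_mem_loc_iff ℓ' ℓ hℓ' hsupp' (S.expo (S.c ℓ) - 1)).mp h)
  have hdual := S.duality ℓ' hℓ' S.ε S.hε d hτd hoff s hs hτs (S.expo (S.c ℓ) - 1)
    (by have := S.expo_le (S.c ℓ); omega) hat
  -- hence `expo s ≤ M - 1 - (k - 1) = M - k ≤ M₀`
  have hle : S.expo s ≤ S.M - 1 - (S.expo (S.c ℓ) - 1) :=
    S.expo_le_of_mem_of_not_mem hdual (fun _ ↦ hsA)
  exact pow_zsmul_eq_zero_of_le (by omega) (S.pow_expo_zsmul s)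

/-- **Claim B♯ (the `ε`-eigenspace): `p^{M₀} s ∈ ℤ x` for every `s ∈ Sel^{ε}`**, under two-place
duality: split `s = k x + s'` with `s'` independent of `x` (`exists_split`) and apply
`claimB_indep_of_duality₂` to `s'`. [cite: GrossLMS1991, §10 Claim 10.3]
[cite: McCallumLMS1991, §2 Prop. 2.2] -/
theorem claimB_of_duality₂
    (hdual₂ : ∀ ℓ ℓ', S.Kol ℓ → S.Kol ℓ' → ℓ ≠ ℓ' → ∀ ν : ℤ, (ν = 1 ∨ ν = -1) → ∀ d, S.τ d = ν • d →
      (∀ v, v ≠ S.pl ℓ → v ≠ S.pl ℓ' → d ∈ S.Loc v) → ∀ s ∈ S.Sel, S.τ s = ν • s → s ∈ S.A ℓ' →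
      ∀ a, a < S.M → ((S.p : ℤ) ^ a) • d ∉ S.Loc (S.pl ℓ) →
        ((S.p : ℤ) ^ (S.M - 1 - a)) • s ∈ S.A ℓ)
    {s : V} (hs : s ∈ S.Sel) (hτs : S.τ s = S.ε • s) :
    ∃ a : ℤ, ((S.p : ℤ) ^ S.M₀) • s = a • S.x := by
  obtain ⟨k, s', hsplit, hind⟩ := S.exists_split s
  have hs'eq : s' = s - k • S.x := by rw [hsplit]; abel
  have hs' : s' ∈ S.Sel := by
    rw [hs'eq]
    exact S.Sel.sub_mem hs (S.Sel.zsmul_mem S.x_mem _)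
  have hτs' : S.τ s' = S.ε • s' := by
    rw [hs'eq, map_sub, map_zsmul, hτs, S.τ_x, zsmul_sub, smul_comm]
  have h0 := S.claimB_indep_of_duality₂ hdual₂ hs' hτs' hind
  refine ⟨(S.p : ℤ) ^ S.M₀ * k, ?_⟩
  rw [hsplit, zsmul_add, h0, add_zero, smul_smul]

/-! ## The annihilation theorem with Kolyvagin's exponent -/

/-- **Kolyvagin's annihilation modulo `p^M` with his exponent: `p^{M₀} · Sel ⊆ ℤ x`**, under
two-place duality.  Every `s ∈ Sel` decomposes (`p` odd, `Sel` `τ`-stable) as `s = s⁺ + s⁻` in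
`Sel`; `p^{M₀} s⁻ = 0` by Claim A and `p^{M₀} s⁺ ∈ ℤ x` by Claim B♯.  In the application
(`V = H¹(K, E_{p^M})`, `x = δ_M x₀`, `M₀ = ord_p [E(K) : ℤ y_K]`) this is
`p^{M₀} S_{p^M}(E/K) ⊆ δ_M(E(K))` — Kolyvagin's `C' S'_M = 0` with `C = p^{M₀}` (ICM 1990, §2) —
hence `p^{M₀} Ш(E/K)_{p^M} = 0` for every `M`. [cite: GrossLMS1991, §10]
[cite: McCallumLMS1991, §1 Theorem (Kolyvagin), §2 Prop. 2.2, §5] -/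
theorem pow_M₀_zsmul_mem_zmultiples
    (hdual₂ : ∀ ℓ ℓ', S.Kol ℓ → S.Kol ℓ' → ℓ ≠ ℓ' → ∀ ν : ℤ, (ν = 1 ∨ ν = -1) → ∀ d, S.τ d = ν • d →
      (∀ v, v ≠ S.pl ℓ → v ≠ S.pl ℓ' → d ∈ S.Loc v) → ∀ s ∈ S.Sel, S.τ s = ν • s → s ∈ S.A ℓ' →
      ∀ a, a < S.M → ((S.p : ℤ) ^ a) • d ∉ S.Loc (S.pl ℓ) →
        ((S.p : ℤ) ^ (S.M - 1 - a)) • s ∈ S.A ℓ)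
    {s : V} (hs : s ∈ S.Sel) :
    ((S.p : ℤ) ^ S.M₀) • s ∈ AddSubgroup.zmultiples S.x := by
  obtain ⟨u, hu⟩ := exists_two_mul_zsmul_eq_of_pow S.hp S.hp2 S.torsion
  have he := S.ε_mul_ε
  set sp := u • (s + S.ε • S.τ s) with hsp
  set sm := u • (s - S.ε • S.τ s) with hsm
  have hτsp : S.τ sp = S.ε • sp := by
    simp only [hsp, map_zsmul, map_add, S.τ_τ]
    linear_combination (norm := module) he • (-(u • S.τ s))
  have hτsm : S.τ sm = (-S.ε) • sm := by
    simp only [hsm, map_zsmul, map_sub, S.τ_τ]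
    linear_combination (norm := module) he • (-(u • S.τ s))
  have hsp_mem : sp ∈ S.Sel :=
    S.Sel.zsmul_mem (S.Sel.add_mem hs (S.Sel.zsmul_mem (S.τ_mem s hs) _)) _
  have hsm_mem : sm ∈ S.Sel :=
    S.Sel.zsmul_mem (S.Sel.sub_mem hs (S.Sel.zsmul_mem (S.τ_mem s hs) _)) _
  have hsm0 : ((S.p : ℤ) ^ S.M₀) • sm = 0 := S.claimA hsm_mem hτsm
  obtain ⟨a, ha⟩ := S.claimB_of_duality₂ hdual₂ hsp_mem hτsp
  have hsum : s = sp + sm := by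
    simp only [hsp, hsm]
    linear_combination (norm := module) (-1 : ℤ) • hu s
  rw [hsum, zsmul_add, hsm0, add_zero, ha]
  exact AddSubgroup.zsmul_mem_zmultiples _ _

end HypothesesM

/-! ## From the descent modulo every `p^j` to `p^{M₀} · Ш(E/K)[p^∞] = 0` -/

section Sha

variable {F : Type u} [Field F] [NumberField F] (E : WeierstrassCurve F)

/-- **Kolyvagin's annihilation `p^{M₀} · Ш(E/K)[p^∞] = 0` from descent data with two-place
duality at the levels `j ≥ j₀`** (the passage to `Ш` of `finite_sha_primary_of_hypothesesM_of_le`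
with `HypothesesM.pow_M₀_zsmul_mem_zmultiples` in place of `pow_zsmul_mem_zmultiples`): a class
`c ∈ Ш(E/K)` killed by `p^j` lifts to `s ∈ S_{p^{j'}}(E/K)`, `j' = max(j, j₀)` (Silverman X.4.2(a),
tree `map_torsionH1ToH1_selmerGroup_holds`), and `p^{M₀} s ∈ ℤ x ⊆ ker(H¹(K, E[p^{j'}]) → H¹(K, E))`,
so `p^{M₀} c = 0`. [cite: McCallumLMS1991, §1 Theorem (Kolyvagin), §2 Prop. 2.2]
[cite: GrossLMS1991, §1 Thm. 1.3 (2) and §10] -/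
theorem pow_M₀_smul_sha_primary_eq_zero_of_hypothesesM_of_le [E.IsElliptic] {p : ℕ} (hp : p.Prime)
    (M₀ j₀ : ℕ) {Pl : ℕ → Type*}
    (S : ∀ j : ℕ, j₀ ≤ j → HypothesesM (galH1Torsion E ((p ^ j : ℕ) : ℤ)) (Pl j))
    (hSp : ∀ j hj, (S j hj).p = p) (hSM : ∀ j hj, (S j hj).M₀ = M₀)
    (hSel : ∀ j hj, (S j hj).Sel = selmerGroup E ((p ^ j : ℕ) : ℤ))
    (hx : ∀ j hj, (S j hj).x ∈ (torsionH1ToH1 E ((p ^ j : ℕ) : ℤ)).ker)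
    (hdual₂ : ∀ j hj, ∀ ℓ ℓ', (S j hj).Kol ℓ → (S j hj).Kol ℓ' → ℓ ≠ ℓ' →
      ∀ ν : ℤ, (ν = 1 ∨ ν = -1) → ∀ d, (S j hj).τ d = ν • d →
      (∀ v, v ≠ (S j hj).pl ℓ → v ≠ (S j hj).pl ℓ' → d ∈ (S j hj).Loc v) →
      ∀ s ∈ (S j hj).Sel, (S j hj).τ s = ν • s → s ∈ (S j hj).A ℓ' →
      ∀ a, a < (S j hj).M → (((S j hj).p : ℤ) ^ a) • d ∉ (S j hj).Loc ((S j hj).pl ℓ) →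
        (((S j hj).p : ℤ) ^ ((S j hj).M - 1 - a)) • s ∈ (S j hj).A ℓ)
    (c : E.sha) (hc : ∃ j : ℕ, p ^ j • c = 0) : p ^ M₀ • c = 0 := by
  obtain ⟨j, hj⟩ := hc
  -- pass to the level `j' = max j j₀`
  set j' := max j j₀ with hj'def
  have hj₀ : j₀ ≤ j' := le_max_right _ _
  have hj' : p ^ j' • c = 0 := by
    have : j' = (j' - j) + j := by omega
    rw [this, pow_add, mul_smul, hj, smul_zero]
  have hn : ((p ^ j' : ℕ) : ℤ) ≠ 0 := by exact_mod_cast pow_ne_zero j' hp.ne_zero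
  have hc' : (c : E.galH1) ∈ E.sha ⊓ AddSubgroup.torsionBy E.galH1 ((p ^ j' : ℕ) : ℤ) := by
    refine AddSubgroup.mem_inf.mpr ⟨c.2, ?_⟩
    rw [mem_torsionBy_iff, natCast_zsmul, ← AddSubgroupClass.coe_nsmul, hj', ZeroMemClass.coe_zero]
  rw [← E.map_torsionH1ToH1_selmerGroup_holds hn, AddSubgroup.mem_map] at hc'
  obtain ⟨s, hs, hts⟩ := hc'
  have hmem := (S j' hj₀).pow_M₀_zsmul_mem_zmultiples (hdual₂ j' hj₀) (s := s) (by rw [hSel]; exact hs)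
  rw [hSp j' hj₀, hSM j' hj₀] at hmem
  have hker : AddSubgroup.zmultiples (S j' hj₀).x ≤ (torsionH1ToH1 E ((p ^ j' : ℕ) : ℤ)).ker :=
    AddSubgroup.zmultiples_le_of_mem (hx j' hj₀)
  have h0 : torsionH1ToH1 E ((p ^ j' : ℕ) : ℤ) (((p : ℤ) ^ M₀) • s) = 0 :=
    (AddMonoidHom.mem_ker).mp (hker hmem)
  rw [map_zsmul, hts] at h0
  apply Subtype.ext
  rw [AddSubgroupClass.coe_nsmul, ZeroMemClass.coe_zero, ← natCast_zsmul, Nat.cast_pow]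
  exact h0

end Sha

end KolyvaginDescent

end Literature.NumberTheory.EllipticCurves

end
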